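import Literature.MathematicalPhysics.QuantumFieldTheory.Balaban1983to89.B8BlockConstantLiftRec

/-!
# `Balaban1983to89.B8BlockConstantLiftDataRec` — [Balaban1985Averaging] (78)–(80) ∕ [Balaban1985RegularSpaces] (1.29) FOR THE RECORD's CENTRED BLOCKING AT THE TRIVIAL BACKGROUND:
# the averaging `R̄₀ʲ` is EXACTLY LEFT-COVARIANT under multiplication by a transformation constant on the block tower — so the restriction data of `h⁻¹·u₀` (road (B′)'s data
# factor) are the cell data of `h⁻¹` times those of `u₀`, WITH NO DEFECT: item (B′-5) of the plan's road (B′) for director-ym №310∕№311's branch (ii), sharpened from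
# «second-order defect ψ₂» to «ψ₂ = 0»

statement-level skeleton of published theorems with citation tags; proofs where landed; nothing here is a claim about the Yang–Mills mass gap

CITATION HEADER (lean-in-tree rule).  Cell `pub-ymgap` (HUMAN RULING D-0062), «N05-REC» road; director-ym №311 (1)(c′) pens «(B′-3) + (B′-5)»; (B′-1) = `B8BlockConstantLiftRec` ✓,
(B′-2) = `B8BlockConstantLiftStabilityRec` ✓, (B′-3) = `B8Prop6OfThm4PrecomposedRec`; THIS FILE = (B′-5).  Pen dag-n05-e g41.  [3] = [Balaban1985Averaging] (78)–(81) p. 30; [6] =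
[Balaban1985RegularSpaces] (1.29) p. 81, (1.135)–(1.138) p. 99; [I] = [Balaban1987RG1] (0.3) p. 252.  `--kind proof --supports stmt-QuantumFields-20541` (K0⁷; count-neutral; no definition).
REUSED BY NAME: `B7Eq78Linearization.{Rbar, Rbar_zero, Rbar_succ, avgStep, avgStep_eq_mul_exp_sum, conjR_apply}`, `B7SectEFLinearisationRec.{zdBlockingZ, bgTZ, blockSitesZ, mem_blockSitesZ}`,
`B8Eq178AveragesRec.smul_mem_blockSitesZ`, `B8Eq119TwistedAxialRec.{UnderZ, underZ_zero_iff, underZ_one_block, underZ_succ_of_underZ_block, bgTZ_one, Restr129Z}`,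
`B8BlockConstantLiftRec.rbar_one_eq_const_of_under` ((B′-1)).

THE POINT (memo `SCOPE-IIB.md` §4, SHARPENED).  In road (B′) the junction's transformation is `w′ = v⁻¹·h⁻¹·u₀` with `h` constant `= X(j, y)` on the block tower under every cell and
`u₀` Theorem 4's output (`Restr129Z … 1 u₀`: `R̄₀ʲu₀ = 1` on the cells).  One (78)-step at the trivial background is `(R̄₀v)(y) = v(L·y)·exp[Σ_x L⁻ᵈ log(v(L·y)⁻¹v(x))]`; for
`v′ = c·v` with `c` CONSTANT on the block the logarithms are UNCHANGED (`(c·v(L·y))⁻¹(c·v(x)) = v(L·y)⁻¹v(x)`) and the prefactor is `c·v(L·y)` — so `R̄₀(c·v) = c·R̄₀v` EXACTLY, and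
by induction down the tower `R̄₀ʲ(h⁻¹·u₀)(y) = X(j,y)⁻¹·R̄₀ʲu₀(y) = X(j,y)⁻¹`: the restriction data of the data factor are met WITHOUT DEFECT in the (79)–(80) currency (the memo's
«ψ₂ = O(|λ₀|·|∇g_c|)» was pessimistic: the cross term vanishes identically because the pre-composition is constant where each datum is read).
WHAT IS PROVED (sorry-free).  §1 `avgStep_const_mul_of_trivial` (one (78)-step, trivial transporters: `avgStep t wt 1 (c·vy) (c·v) = c·avgStep t wt 1 vy v`); §2 ★★
`rbar_one_const_mul_of_under` (odd `L`: `g = c` on `Bʲ(y)` ⇒ `R̄₀ʲ(g·u)(y) = c·R̄₀ʲu(y)`); §3 ★★★ `rbar_one_blockConstant_mul_eq_data` — `g` constant `= X(j,y)` under every cell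
`(j, y)`, `j ≤ k`, and `Restr129Z L k Λ 1 u` ⇒ `R̄₀ʲ(g·u)(y) = X(j,y)` on every cell: THE DATA ARE EXACT; `restr129Z_blockConstant_mul_iff` (with `X ≡ 1`-valued cells … ) is not
needed and not stated.
HONEST SCOPE.  Finite bookkeeping of (78)–(80) at the trivial background; NO estimate of Bałaban's; whether the head's row 9′ reads its unit-block-average condition in this (79)–(80)
currency (then road (B′) meets it EXACTLY) or in another group average (then a currency bridge on the N07 side) is n07-e's (Q-R̄); `HThm4Rec*` CONDITIONAL; N05 DISCHARGED OF RECORD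
since R467 (count-neutral record-level work), N07 NOT discharged; counts unmoved (typed 28∕28 · discharged 8∕28); one finite 𝕋⁴ programme at fixed ε, `G = SU(2)` of record — nothing
continuum ∕ ℝ⁴ ∕ OS ∕ mass gap ∕ Clay.  No `def`, no `instance`, no `notation`, no `sorry`.
-/

set_option autoImplicit false

noncomputable section

open scoped BigOperators

namespace Literature.MathematicalPhysics.QuantumFieldTheory.Balaban1983to89.B8BlockConstantLiftDataRec

open NormedSpace
open B7Prop1Explicit hiding Site
open B7Prop1Explicit renaming Site → SiteZ
open MatrixLog (mlog)
open B7Eq78Linearization (Rbar Rbar_zero Rbar_succ avgStep avgStep_eq_mul_exp_sum conjR conjR_apply)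
open B7SectEFLinearisationRec (zdBlockingZ bgTZ blockSitesZ mem_blockSitesZ)
open BlockAveragingZd (offZ)
open B8Eq178AveragesRec (smul_mem_blockSitesZ)
open B8Eq119TwistedAxialRec (UnderZ underZ_zero_iff underZ_one_block underZ_succ_of_underZ_block bgTZ_one Restr129Z)

variable {d : ℕ}
variable {𝔸 : Type*} [NormedRing 𝔸] [NormOneClass 𝔸] [NormedAlgebra ℂ 𝔸] [CompleteSpace 𝔸]

/-! ## §1  One (78)-step is exactly left-covariant under a constant factor (trivial transporters) -/

omit [NormOneClass 𝔸] [CompleteSpace 𝔸] in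
/-- **(78) at the trivial background commutes with a CONSTANT left factor**: with transporters `T_x = 1` on the block, `(R̄₀(c·v))(y) = c·v(y)·exp[Σ_x wt_x log((c·v(y))⁻¹(c·v(x)))]
= c·(R̄₀v)(y)` for a unit `c` — the logarithms do not see `c`. [cite: Balaban1985Averaging, (78) p.30] -/
theorem avgStep_const_mul_of_trivial {ι : Type*} (t : Finset ι) (wt : ι → ℝ) {T : ι → 𝔸ˣ} (hT : ∀ x ∈ t, T x = 1) (c vy : 𝔸ˣ)
    {v v' : ι → 𝔸} (hv' : ∀ x ∈ t, v' x = (c : 𝔸) * v x) :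
    avgStep t wt T ((c * vy : 𝔸ˣ) : 𝔸) v' = (c : 𝔸) * avgStep t wt T (vy : 𝔸) v := by
  rw [avgStep_eq_mul_exp_sum, avgStep_eq_mul_exp_sum]
  have hsum : (∑ x ∈ t, wt x • mlog (Ring.inverse ((c * vy : 𝔸ˣ) : 𝔸) * conjR (T x) (v' x))) =
      ∑ x ∈ t, wt x • mlog (Ring.inverse (vy : 𝔸) * conjR (T x) (v x)) := by
    refine Finset.sum_congr rfl fun x hx => ?_
    have hkey : Ring.inverse ((c * vy : 𝔸ˣ) : 𝔸) * conjR (T x) (v' x) = Ring.inverse (vy : 𝔸) * conjR (T x) (v x) := by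
      simp only [hv' x hx, hT x hx, conjR_apply, Units.val_one, inv_one, one_mul, mul_one, Ring.inverse_unit]
      rw [← mul_assoc, ← Units.val_mul, mul_inv_rev, inv_mul_cancel_right]
    rw [hkey]
  rw [hsum, Units.val_mul, mul_assoc]

/-! ## §2  `R̄₀ʲ(g·u) = c·R̄₀ʲu` for `g` constant `= c` on the block tower under `y` -/

omit [NormOneClass 𝔸] in
/-- ★★ **`R̄₀ʲ` IS EXACTLY LEFT-COVARIANT UNDER A TRANSFORMATION CONSTANT ON THE BLOCK TOWER** ([3] (79)–(80), record blocking `zdBlockingZ`, trivial background; odd `L`): if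
`g(x) = c` for every `x ∈ Bʲ(y)`, then `Rbar … j (g·u) y = c·Rbar … j u y` (pointwise product `(g·u)(x) = g(x)u(x)`), by induction on `j` with §1.
[cite: Balaban1985Averaging, (78)–(80) p.30; Balaban1985RegularSpaces, (1.29) p.81; Balaban1987RG1, (0.3) p.252] -/
theorem rbar_one_const_mul_of_under {L : ℕ} (hL : Odd L) (g u : SiteZ d → 𝔸ˣ) (c : 𝔸ˣ) :
    ∀ (j : ℕ) (y : SiteZ d), (∀ x, UnderZ L j y x → g x = c) →
      Rbar (zdBlockingZ d L) (bgTZ L (1 : SiteZ d → Fin d → 𝔸ˣ)) j (fun x => (((g * u) x : 𝔸ˣ) : 𝔸)) y =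
        (c : 𝔸) * Rbar (zdBlockingZ d L) (bgTZ L (1 : SiteZ d → Fin d → 𝔸ˣ)) j (fun x => ((u x : 𝔸ˣ) : 𝔸)) y
  | 0, y, h => by
    rw [Rbar_zero, Rbar_zero, Pi.mul_apply, Units.val_mul, h y ((underZ_zero_iff L y y).2 rfl)]
  | j + 1, y, h => by
    obtain ⟨s, hs⟩ := hL
    have hLs : L = 2 * s + 1 := hs
    have hL1 : 1 ≤ L := by omega
    have IH : ∀ x ∈ blockSitesZ L y,
        Rbar (zdBlockingZ d L) (bgTZ L (1 : SiteZ d → Fin d → 𝔸ˣ)) j (fun x => (((g * u) x : 𝔸ˣ) : 𝔸)) x =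
          (c : 𝔸) * Rbar (zdBlockingZ d L) (bgTZ L (1 : SiteZ d → Fin d → 𝔸ˣ)) j (fun x => ((u x : 𝔸ˣ) : 𝔸)) x := by
      intro x hx
      obtain ⟨r, rfl⟩ := mem_blockSitesZ.1 hx
      exact rbar_one_const_mul_of_under ⟨s, hs⟩ g u c j _ fun z hz =>
        h z (underZ_succ_of_underZ_block ⟨s, hs⟩ (underZ_one_block hLs y r) hz)
    -- the base value at the centre `L·y` is a unit: `R̄₀ʲu(L·y) = uavgZ … ∈ 𝔸ˣ`
    have hbase := IH _ (smul_mem_blockSitesZ hL1 y)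
    rw [Rbar_succ, Rbar_succ]
    show avgStep (blockSitesZ L y) (fun _ => ((L : ℝ) ^ d)⁻¹) (bgTZ L (1 : SiteZ d → Fin d → 𝔸ˣ) j y)
        (Rbar (zdBlockingZ d L) (bgTZ L (1 : SiteZ d → Fin d → 𝔸ˣ)) j (fun x => (((g * u) x : 𝔸ˣ) : 𝔸)) ((L : ℤ) • y))
        (Rbar (zdBlockingZ d L) (bgTZ L (1 : SiteZ d → Fin d → 𝔸ˣ)) j (fun x => (((g * u) x : 𝔸ˣ) : 𝔸))) =
      (c : 𝔸) * avgStep (blockSitesZ L y) (fun _ => ((L : ℝ) ^ d)⁻¹) (bgTZ L (1 : SiteZ d → Fin d → 𝔸ˣ) j y)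
        (Rbar (zdBlockingZ d L) (bgTZ L (1 : SiteZ d → Fin d → 𝔸ˣ)) j (fun x => ((u x : 𝔸ˣ) : 𝔸)) ((L : ℤ) • y))
        (Rbar (zdBlockingZ d L) (bgTZ L (1 : SiteZ d → Fin d → 𝔸ˣ)) j (fun x => ((u x : 𝔸ˣ) : 𝔸)))
    -- the base value of `u` is the unit `uavgZ L 1 u j (L·y)`
    have hunit : Rbar (zdBlockingZ d L) (bgTZ L (1 : SiteZ d → Fin d → 𝔸ˣ)) j (fun x => ((u x : 𝔸ˣ) : 𝔸)) ((L : ℤ) • y) =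
        ((B7SectCDGaugeAveragesRec.uavgZ L (1 : SiteZ d → Fin d → 𝔸ˣ) u j ((L : ℤ) • y) : 𝔸ˣ) : 𝔸) := by
      rw [B8Eq178AveragesRec.rbar_bgTZ_eq_uavgZ L (1 : SiteZ d → Fin d → 𝔸ˣ) u j]
    rw [hbase, hunit, ← Units.val_mul]
    exact avgStep_const_mul_of_trivial _ _ (fun x _ => by rw [bgTZ_one]) c _ IH

/-! ## §3  The restriction data of `g·u₀` are EXACTLY the cell data of `g` when `R̄₀ʲu₀ = 1` on the cells -/

omit [NormOneClass 𝔸] in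
/-- ★★★ **THE DATA FACTOR OF ROAD (B′) MEETS ITS RESTRICTION DATA EXACTLY** ([6] (1.29) with data, record blocking, trivial background; odd `L`): if `g` is constant `= X(j, y)` on the
block tower under every cell `y ∈ Λ_j`, `j ≤ k`, and `u` satisfies (1.29) (`Restr129Z L k Λ 1 u`: `R̄₀ʲu = 1` on the cells — Theorem 4's output), then `R̄₀ʲ(g·u)(y) = X(j, y)` on every
cell — NO defect.  (Apply to `g := h⁻¹`, `u := u₀` of `B8Prop6OfThm4PrecomposedRec.prop6_of_thm4_precomposed`: the junction's `w′ = v⁻¹·(h⁻¹·u₀)` carries the prescribed cell data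
`X⁻¹` exactly.) [cite: Balaban1985RegularSpaces, (1.29) p.81, (1.135)–(1.138) p.99; Balaban1985Averaging, (79)–(80) p.30; Balaban1987RG1, (0.3) p.252] -/
theorem rbar_one_blockConstant_mul_eq_data {L : ℕ} (hL : Odd L) (k : ℕ) (Λ : ℕ → Set (SiteZ d)) (X : ℕ → SiteZ d → 𝔸ˣ) (g u : SiteZ d → 𝔸ˣ)
    (hg : ∀ j, j ≤ k → ∀ y ∈ Λ j, ∀ x, UnderZ L j y x → g x = X j y) (hu : Restr129Z L k Λ (1 : SiteZ d → Fin d → 𝔸ˣ) u) :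
    ∀ j, j ≤ k → ∀ y ∈ Λ j,
      Rbar (zdBlockingZ d L) (bgTZ L (1 : SiteZ d → Fin d → 𝔸ˣ)) j (fun x => (((g * u) x : 𝔸ˣ) : 𝔸)) y = X j y := by
  intro j hj y hy
  rw [rbar_one_const_mul_of_under hL g u (X j y) j y (hg j hj y hy), hu j hj y hy, mul_one]

/-! ## §4  Right covariance: `R̄₀ʲ(u·g) = R̄₀ʲu·c` for `g` constant `= c` on the block tower (conjugation commutes with `log`∕`exp`) -/

section Right

omit [NormOneClass 𝔸] in
/-- **(78) at the trivial background is exactly RIGHT-covariant under a CONSTANT factor**: `(R̄₀(v·c))(y) = (R̄₀v)(y)·c` — the logarithms are conjugated by `c⁻¹`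
(`log(c⁻¹wc) = c⁻¹(log w)c`, `exp` likewise), and `v(y)c·c⁻¹E c = v(y)E c`. [cite: Balaban1985Averaging, (78) p.30] -/
theorem avgStep_mul_const_of_trivial {ι : Type*} (t : Finset ι) (wt : ι → ℝ) {T : ι → 𝔸ˣ} (hT : ∀ x ∈ t, T x = 1) (c vy : 𝔸ˣ)
    {v v' : ι → 𝔸} (hv' : ∀ x ∈ t, v' x = v x * (c : 𝔸)) :
    avgStep t wt T ((vy * c : 𝔸ˣ) : 𝔸) v' = avgStep t wt T (vy : 𝔸) v * (c : 𝔸) := by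
  rw [avgStep_eq_mul_exp_sum, avgStep_eq_mul_exp_sum]
  have hsum : (∑ x ∈ t, wt x • mlog (Ring.inverse ((vy * c : 𝔸ˣ) : 𝔸) * conjR (T x) (v' x))) =
      ((c⁻¹ : 𝔸ˣ) : 𝔸) * (∑ x ∈ t, wt x • mlog (Ring.inverse (vy : 𝔸) * conjR (T x) (v x))) * (c : 𝔸) := by
    rw [Finset.mul_sum, Finset.sum_mul]
    refine Finset.sum_congr rfl fun x hx => ?_
    have hkey : Ring.inverse ((vy * c : 𝔸ˣ) : 𝔸) * conjR (T x) (v' x) =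
        ((c⁻¹ : 𝔸ˣ) : 𝔸) * (Ring.inverse (vy : 𝔸) * conjR (T x) (v x)) * (((c⁻¹)⁻¹ : 𝔸ˣ) : 𝔸) := by
      rw [Ring.inverse_unit, Ring.inverse_unit, hv' x hx, hT x hx, conjR_apply, conjR_apply]
      simp only [Units.val_one, inv_one, one_mul, mul_one, inv_inv, mul_inv_rev, Units.val_mul, mul_assoc]
    rw [hkey, B7Prop6Flat.mlog_conj, inv_inv, mul_smul_comm, smul_mul_assoc]
  letI : NormedAlgebra ℚ 𝔸 := NormedAlgebra.restrictScalars ℚ ℂ 𝔸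
  rw [hsum, NormedSpace.exp_units_conj', Units.val_mul]
  simp only [← mul_assoc]
  rw [Units.mul_inv_cancel_right]

omit [NormOneClass 𝔸] in
/-- ★★ **`R̄₀ʲ` IS EXACTLY RIGHT-COVARIANT UNDER A TRANSFORMATION CONSTANT ON THE BLOCK TOWER** ([3] (79)–(80), record blocking, trivial background; odd `L`): if `g(x) = c` on
`Bʲ(y)`, then `Rbar … j (u·g) y = Rbar … j u y · c`. [cite: Balaban1985Averaging, (78)–(80) p.30; Balaban1985RegularSpaces, (1.29) p.81; Balaban1987RG1, (0.3) p.252] -/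
theorem rbar_one_mul_const_of_under {L : ℕ} (hL : Odd L) (u g : SiteZ d → 𝔸ˣ) (c : 𝔸ˣ) :
    ∀ (j : ℕ) (y : SiteZ d), (∀ x, UnderZ L j y x → g x = c) →
      Rbar (zdBlockingZ d L) (bgTZ L (1 : SiteZ d → Fin d → 𝔸ˣ)) j (fun x => (((u * g) x : 𝔸ˣ) : 𝔸)) y =
        Rbar (zdBlockingZ d L) (bgTZ L (1 : SiteZ d → Fin d → 𝔸ˣ)) j (fun x => ((u x : 𝔸ˣ) : 𝔸)) y * (c : 𝔸)
  | 0, y, h => by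
    rw [Rbar_zero, Rbar_zero, Pi.mul_apply, Units.val_mul, h y ((underZ_zero_iff L y y).2 rfl)]
  | j + 1, y, h => by
    obtain ⟨s, hs⟩ := hL
    have hLs : L = 2 * s + 1 := hs
    have hL1 : 1 ≤ L := by omega
    have IH : ∀ x ∈ blockSitesZ L y,
        Rbar (zdBlockingZ d L) (bgTZ L (1 : SiteZ d → Fin d → 𝔸ˣ)) j (fun x => (((u * g) x : 𝔸ˣ) : 𝔸)) x =
          Rbar (zdBlockingZ d L) (bgTZ L (1 : SiteZ d → Fin d → 𝔸ˣ)) j (fun x => ((u x : 𝔸ˣ) : 𝔸)) x * (c : 𝔸) := by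
      intro x hx
      obtain ⟨r, rfl⟩ := mem_blockSitesZ.1 hx
      exact rbar_one_mul_const_of_under ⟨s, hs⟩ u g c j _ fun z hz =>
        h z (underZ_succ_of_underZ_block ⟨s, hs⟩ (underZ_one_block hLs y r) hz)
    have hbase := IH _ (smul_mem_blockSitesZ hL1 y)
    rw [Rbar_succ, Rbar_succ]
    show avgStep (blockSitesZ L y) (fun _ => ((L : ℝ) ^ d)⁻¹) (bgTZ L (1 : SiteZ d → Fin d → 𝔸ˣ) j y)
        (Rbar (zdBlockingZ d L) (bgTZ L (1 : SiteZ d → Fin d → 𝔸ˣ)) j (fun x => (((u * g) x : 𝔸ˣ) : 𝔸)) ((L : ℤ) • y))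
        (Rbar (zdBlockingZ d L) (bgTZ L (1 : SiteZ d → Fin d → 𝔸ˣ)) j (fun x => (((u * g) x : 𝔸ˣ) : 𝔸))) =
      avgStep (blockSitesZ L y) (fun _ => ((L : ℝ) ^ d)⁻¹) (bgTZ L (1 : SiteZ d → Fin d → 𝔸ˣ) j y)
        (Rbar (zdBlockingZ d L) (bgTZ L (1 : SiteZ d → Fin d → 𝔸ˣ)) j (fun x => ((u x : 𝔸ˣ) : 𝔸)) ((L : ℤ) • y))
        (Rbar (zdBlockingZ d L) (bgTZ L (1 : SiteZ d → Fin d → 𝔸ˣ)) j (fun x => ((u x : 𝔸ˣ) : 𝔸))) * (c : 𝔸)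
    have hunit : Rbar (zdBlockingZ d L) (bgTZ L (1 : SiteZ d → Fin d → 𝔸ˣ)) j (fun x => ((u x : 𝔸ˣ) : 𝔸)) ((L : ℤ) • y) =
        ((B7SectCDGaugeAveragesRec.uavgZ L (1 : SiteZ d → Fin d → 𝔸ˣ) u j ((L : ℤ) • y) : 𝔸ˣ) : 𝔸) := by
      rw [B8Eq178AveragesRec.rbar_bgTZ_eq_uavgZ L (1 : SiteZ d → Fin d → 𝔸ˣ) u j]
    rw [hbase, hunit, ← Units.val_mul]
    exact avgStep_mul_const_of_trivial _ _ (fun x _ => by rw [bgTZ_one]) c _ IH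

omit [NormOneClass 𝔸] in
/-- ★★★ **THE u₀-FREE SYM NORMALISATION IS MET EXACTLY BY THE CELL DATUM `X(j, y) := R̄₀ʲa(y)`** (two-sided covariance): for `g` constant `= (R̄₀ʲa(y))⁻¹`-valued … precisely: if
`g(x) = X(j,y)⁻¹` on the tower under the cell `y` and `X(j,y) = Rbar … j a y` (a unit), then `Rbar … j (a·g) y = 1`.  (Road (B′): `a := g_sr` the sym∕radial tower transport, `g := h⁻¹`;
the junction's full product `g_sr·h⁻¹·u₀` then differs from `1` only by the cross term with `u₀`, second order.) [cite: Balaban1985Averaging, (79)–(80) p.30; Balaban1985Variational, (100) p.47; Balaban1985RegularSpaces, (1.29) p.81] -/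
theorem rbar_one_mul_blockConstant_eq_one {L : ℕ} (hL : Odd L) (a g : SiteZ d → 𝔸ˣ) (j : ℕ) (y : SiteZ d) (X : 𝔸ˣ)
    (hX : (X : 𝔸) = Rbar (zdBlockingZ d L) (bgTZ L (1 : SiteZ d → Fin d → 𝔸ˣ)) j (fun x => ((a x : 𝔸ˣ) : 𝔸)) y)
    (hg : ∀ x, UnderZ L j y x → g x = X⁻¹) :
    Rbar (zdBlockingZ d L) (bgTZ L (1 : SiteZ d → Fin d → 𝔸ˣ)) j (fun x => (((a * g) x : 𝔸ˣ) : 𝔸)) y = 1 := by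
  rw [rbar_one_mul_const_of_under hL a g X⁻¹ j y hg, ← hX, Units.mul_inv]

end Right

end Literature.MathematicalPhysics.QuantumFieldTheory.Balaban1983to89.B8BlockConstantLiftDataRec
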